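import Literature.NumberTheory.LFunctions.FordLemma32B
import HarnessLib

/-!
# Ford's Lemma 3.2 (general `d`), part C: the boundary trick (`S₄ ≤ 2S₆`) and the re-expansion

Topic `Literature/NumberTheory/LFunctions`. Everything here is PROVED.

K. Ford, Proc. LMS 85 (2002), proof of Lemma 3.2, from (3.5) to (3.6): writing the variables of the
residue class as `x = pu − c̃` (`c̃ ≡ −c`), the solutions with some `u_i > Q/p` or `v_i > Q/p` (`S₅`)
are few by Hölder (`S₄ ≤ (4s)^{2s} ∫|F̃|²` would contradict the diagonal `S₄ ≥ (Q/p)^s ∫|F̃|²` when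
`Q/p ≥ 16 s²`), so `S₄ ≤ 2S₆`; and the `S₆` solutions solve the translated system
`∑(Φ_j(z_i) − Φ_j(w_i)) + (pq)^j ∑ (u_i^j − v_i^j) = 0` with `Φ = transl (c̃ q) Ψ`, `1 ≤ u_i,v_i ≤ Q/p`
(`FordVK.S4_le_two_S6'`).

## References

* K. Ford, Proc. London Math. Soc. (3) 85 (2002), 565–633, proof of Lemma 3.2, (3.5)–(3.6).
  [Ford2002]
-/

noncomputable section

open Finset MeasureTheory Polynomial Complex
open scoped Real ComplexConjugate

namespace Literature.NumberTheory.LFunctions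
namespace FordVK

open VMV

section StepE

variable {k : ℕ} (s P Q : ℕ) (Ψ : PSystem k) (q : ℤ) (d n : ℕ) (hnd : n + d ≤ k) (p : ℕ) (c : ℤ)

/-- The solution set behind `S₄(c,p)`. [cite: Ford2002, (3.5)] -/
def Sol4 : Finset (((Fin k → ℤ) × (Fin s → ℤ)) × ((Fin k → ℤ) × (Fin s → ℤ))) :=
  ((Zt P Ψ d n hnd p ×ˢ tuples s (Xc Q p c)) ×ˢ (Zt P Ψ d n hnd p ×ˢ tuples s (Xc Q p c))).filter
    fun a => Kfreq Ψ q a.1 = Kfreq Ψ q a.2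

/-- Auxiliary step (elementary consequence of the standing hypotheses). [folklore] -/
theorem card_Sol4 : (Sol4 s P Q Ψ q d n hnd p c).card = S4 s P Q Ψ q d n hnd p c := rfl

/-- Auxiliary step (elementary consequence of the standing hypotheses). [folklore] -/
theorem mem_Sol4 {a} : a ∈ Sol4 s P Q Ψ q d n hnd p c ↔
    ((a.1.1 ∈ Zt P Ψ d n hnd p ∧ a.1.2 ∈ tuples s (Xc Q p c)) ∧ (a.2.1 ∈ Zt P Ψ d n hnd p ∧ a.2.2 ∈ tuples s (Xc Q p c)))
      ∧ Kfreq Ψ q a.1 = Kfreq Ψ q a.2 := by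
  rw [Sol4, mem_filter, mem_product, mem_product, mem_product]

/-- `c̃ = (−c) mod p ∈ [0,p)`, so that `x ≡ c` iff `p ∣ x + c̃`. [cite: Ford2002, proof of Lemma 3.2 ("x_i = pu_i − c")] -/
def ctil : ℤ := (-c) % p

/-- The "top cell" `x > Q − c̃` (i.e. `u > Q/p`). [cite: Ford2002, proof of Lemma 3.2 (`S₅`)] -/
def Top (x : ℤ) : Prop := (Q : ℤ) - ctil p c < x

/-- Auxiliary step (elementary consequence of the standing hypotheses). [folklore] -/
instance (x : ℤ) : Decidable (Top Q p c x) := by unfold Top; infer_instance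

/-- `S₆`: no variable in the top cell. [cite: Ford2002, proof of Lemma 3.2 (`S₆`)] -/
def Sol6 : Finset (((Fin k → ℤ) × (Fin s → ℤ)) × ((Fin k → ℤ) × (Fin s → ℤ))) :=
  (Sol4 s P Q Ψ q d n hnd p c).filter fun a => (∀ i, ¬ Top Q p c (a.1.2 i)) ∧ ∀ i, ¬ Top Q p c (a.2.2 i)

/-- The `Z̃`-pair count `Z = ∫ |F̃|² = #{(z,w) ∈ Z̃² : ∑Ψ(z_i) = ∑Ψ(w_i)}`. [cite: Ford2002, proof of Lemma 3.2 ("∫ |F̃(α)|² dα")] -/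
def Zcount : ℕ := ((Zt P Ψ d n hnd p ×ˢ Zt P Ψ d n hnd p).filter fun zw => tupSum (sysv Ψ) zw.1 = tupSum (sysv Ψ) zw.2).card

/-- Auxiliary step (elementary consequence of the standing hypotheses). [folklore] -/
theorem Zcount_eq_integral : (Zcount P Ψ d n hnd p : ℝ) = ∫ α in box k, absFt P Ψ d n hnd p α ^ 2 := by
  rw [Zcount, ← integral_norm_sq_tp]; rfl

/-! #### The top cell has at most one element of the class -/

omit s P Ψ q d n hnd in
/-- Two elements of the class `x ≡ c (mod p)` in the top cell `(Q − c̃, Q]` coincide. [cite: Ford2002, proof of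
Lemma 3.2 (the variable with `u_i > Q/p` is determined)] -/
theorem top_unique (hp : 0 < p) {x x' : ℤ} (hx : x ∈ Xc Q p c) (hx' : x' ∈ Xc Q p c) (ht : Top Q p c x) (ht' : Top Q p c x') :
    x = x' := by
  rw [Xc, mem_filter, Finset.mem_Icc] at hx hx'
  simp only [Top, ctil] at ht ht'
  have hp' : (0 : ℤ) < p := by exact_mod_cast hp
  have hlt : (-c) % p < p := Int.emod_lt_of_pos _ hp'
  have h0 : 0 ≤ (-c) % p := Int.emod_nonneg _ hp'.ne'
  -- `p ∣ x − x'` and `|x − x'| < p`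
  have hdvd : (p : ℤ) ∣ x - x' := by
    have := dvd_sub hx.2 hx'.2; rwa [sub_sub_sub_cancel_right] at this
  obtain ⟨t, ht⟩ := hdvd
  have habs : |x - x'| < p := by rw [abs_lt]; constructor <;> linarith [hx.1.2, hx'.1.2]
  rw [ht, abs_mul, abs_of_pos hp'] at habs
  have : |t| < 1 := by
    by_contra hh; push Not at hh
    have : (p : ℤ) * 1 ≤ p * |t| := mul_le_mul_of_nonneg_left hh hp'.le
    linarith
  have ht0 : t = 0 := by rw [abs_lt] at this; omega
  rw [ht0, mul_zero, sub_eq_zero] at ht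
  exact ht

/-! #### The class as `u`-values -/

omit s P Ψ q d n hnd in
/-- `x ↦ u = (x + c̃)/p` maps the class `Xc` into `[1, (Q + c̃)/p]` and `x ≤ Q − c̃` into `u ≤ Q/p`; it is
inverted by `u ↦ pu − c̃`. [cite: Ford2002, proof of Lemma 3.2 ("x_i = pu_i − c, 1 ≤ u_i ≤ (Q+c)/p")] -/
theorem dvd_add_ctil {x : ℤ} (hx : x ∈ Xc Q p c) : (p : ℤ) ∣ x + ctil p c := by
  rw [Xc, mem_filter] at hx
  simp only [ctil]
  have h1 : (p : ℤ) ∣ (-c) % p - (-c) := (Int.mod_modEq (-c) p).symm.dvd |> fun h => by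
    have := (Int.mod_modEq (-c) (p : ℤ)).dvd; simpa using dvd_neg.2 this
  have := dvd_add hx.2 h1
  have e : x - c + ((-c) % ↑p - -c) = x + (-c) % p := by ring
  rwa [e] at this

omit s P Ψ q d n hnd in
/-- Auxiliary step (elementary consequence of the standing hypotheses). [folklore] -/
theorem one_le_udiv (hp : 0 < p) {x : ℤ} (hx : x ∈ Xc Q p c) : 1 ≤ (x + ctil p c) / p := by
  have hp' : (0 : ℤ) < p := by exact_mod_cast hp
  obtain ⟨t, ht⟩ := dvd_add_ctil Q p c hx
  rw [Xc, mem_filter, Finset.mem_Icc] at hx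
  have h0 : 0 ≤ ctil p c := Int.emod_nonneg _ hp'.ne'
  rw [ht, Int.mul_ediv_cancel_left _ hp'.ne']
  by_contra hh; push Not at hh
  have : (p : ℤ) * t ≤ 0 := mul_nonpos_of_nonneg_of_nonpos hp'.le (by omega)
  linarith [hx.1.1]

omit s P Ψ q d n hnd in
/-- For `x` in the class and not in the top cell: `u = (x + c̃)/p ≤ Q/p`, i.e. `u ∈ [1, Q/p]`. [folklore] -/
theorem udiv_mem (hp : 0 < p) {x : ℤ} (hx : x ∈ Xc Q p c) (hnt : ¬ Top Q p c x) :
    (x + ctil p c) / p ∈ Finset.Icc (1 : ℤ) ((Q / p : ℕ) : ℤ) := by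
  have hp' : (0 : ℤ) < p := by exact_mod_cast hp
  rw [Finset.mem_Icc]
  refine ⟨one_le_udiv Q p c hp hx, ?_⟩
  simp only [Top, not_lt] at hnt
  obtain ⟨t, ht⟩ := dvd_add_ctil Q p c hx
  rw [ht, Int.mul_ediv_cancel_left _ hp'.ne']
  have h1 : (p : ℤ) * t ≤ Q := by linarith
  have : t ≤ (Q : ℤ) / p := Int.le_ediv_of_mul_le hp' (by linarith)
  rw [Int.natCast_div]; exact this

omit s P Ψ q d n hnd in
/-- The number of `x ∈ Xc` is at least `Q/p` when the top cell is occupied: then the `u`-values are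
exactly `1, …, u₀` with `u₀ > Q/p`. We use the weaker `|Xc| ≥ Q/p` (real). [cite: Ford2002, proof of
Lemma 3.2 ("Note that ⌊(Q+c)/p⌋ > Q/p in this case")] -/
theorem card_Xc_ge (hp : 0 < p) {t₀ : ℤ} (ht₀ : t₀ ∈ Xc Q p c) (htop : Top Q p c t₀) :
    (Q : ℝ) / p ≤ (Xc Q p c).card := by
  classical
  have hp' : (0 : ℤ) < p := by exact_mod_cast hp
  obtain ⟨u₀, hu₀⟩ := dvd_add_ctil Q p c ht₀
  have hmem := ht₀
  rw [Xc, mem_filter, Finset.mem_Icc] at ht₀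
  simp only [Top] at htop
  have hc0 : 0 ≤ ctil p c := Int.emod_nonneg _ hp'.ne'
  have hclt : ctil p c < p := Int.emod_lt_of_pos _ hp'
  -- the elements `p u − c̃`, `u = 1..u₀`, all lie in `Xc`
  have hu₀pos : 0 < u₀ := by
    by_contra hh; push Not at hh
    have : (p : ℤ) * u₀ ≤ 0 := mul_nonpos_of_nonneg_of_nonpos hp'.le hh
    linarith
  have hsub : (Finset.Icc (1 : ℤ) u₀).image (fun u => (p : ℤ) * u - ctil p c) ⊆ Xc Q p c := by
    intro x hx
    rw [mem_image] at hx; obtain ⟨u, hu, rfl⟩ := hx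
    rw [Finset.mem_Icc] at hu
    rw [Xc, mem_filter, Finset.mem_Icc]
    refine ⟨⟨by nlinarith, ?_⟩, ?_⟩
    · have : (p : ℤ) * u ≤ p * u₀ := mul_le_mul_of_nonneg_left hu.2 hp'.le
      linarith
    · -- `p ∣ (pu − c̃) − c` since `c̃ ≡ −c`
      have h1 : (p : ℤ) ∣ ctil p c + c := by
        simp only [ctil]
        have := (Int.mod_modEq (-c) (p : ℤ)).dvd  -- p ∣ -c - (-c) % p
        have e : ((-c) % (p : ℤ)) + c = -((-c) - (-c) % p) := by ring
        rw [e]; exact (dvd_neg.2 this)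
      have : (p : ℤ) * u - ctil p c - c = p * u - (ctil p c + c) := by ring
      rw [this]; exact dvd_sub (dvd_mul_right _ _) h1
  have hinj : Set.InjOn (fun u => (p : ℤ) * u - ctil p c) ↑(Finset.Icc (1 : ℤ) u₀) := by
    intro u _ u' _ h; simp only at h
    have := mul_left_cancel₀ hp'.ne' (by linarith : (p : ℤ) * u = p * u')
    exact this
  have hcard := card_le_card hsub
  rw [card_image_of_injOn hinj, Int.card_Icc] at hcard
  have hu₀R : (Q : ℝ) / p ≤ u₀ := by
    rw [div_le_iff₀ (by exact_mod_cast hp)]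
    have : (Q : ℤ) < p * u₀ := by linarith
    have : (Q : ℝ) < (p : ℝ) * u₀ := by exact_mod_cast this
    linarith
  have e : ((u₀ + 1 - 1).toNat : ℤ) = u₀ := by rw [add_sub_cancel_right, Int.toNat_of_nonneg hu₀pos.le]
  have hcardR : (u₀ : ℝ) ≤ (Xc Q p c).card := by
    have : (((u₀ + 1 - 1).toNat : ℤ) : ℝ) ≤ (Xc Q p c).card := by exact_mod_cast hcard
    rw [e] at this; exact_mod_cast this
  exact hu₀R.trans hcardR

/-! #### Symmetries of `Sol4` -/

/-- Solutions with `x_i` in the top cell. [cite: Ford2002, proof of Lemma 3.2 (`S₅`)] -/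
def Sol4X (i : Fin s) : Finset (((Fin k → ℤ) × (Fin s → ℤ)) × ((Fin k → ℤ) × (Fin s → ℤ))) :=
  (Sol4 s P Q Ψ q d n hnd p c).filter fun a => Top Q p c (a.1.2 i)

/-- Solutions with `y_i` in the top cell. [cite: Ford2002, proof of Lemma 3.2 (`S₅`)] -/
def Sol4Y (i : Fin s) : Finset (((Fin k → ℤ) × (Fin s → ℤ)) × ((Fin k → ℤ) × (Fin s → ℤ))) :=
  (Sol4 s P Q Ψ q d n hnd p c).filter fun a => Top Q p c (a.2.2 i)

/-- Auxiliary step (elementary consequence of the standing hypotheses). [folklore] -/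
theorem card_Sol4Y_eq (i : Fin s) : (Sol4Y s P Q Ψ q d n hnd p c i).card = (Sol4X s P Q Ψ q d n hnd p c i).card := by
  refine card_bij' (fun a _ => (a.2, a.1)) (fun a _ => (a.2, a.1)) ?_ ?_ (fun a _ => rfl) (fun a _ => rfl)
  · intro a ha
    rw [Sol4Y, mem_filter, mem_Sol4] at ha
    rw [Sol4X, mem_filter, mem_Sol4]
    exact ⟨⟨⟨ha.1.1.2, ha.1.1.1⟩, ha.1.2.symm⟩, ha.2⟩
  · intro a ha
    rw [Sol4X, mem_filter, mem_Sol4] at ha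
    rw [Sol4Y, mem_filter, mem_Sol4]
    exact ⟨⟨⟨ha.1.1.2, ha.1.1.1⟩, ha.1.2.symm⟩, ha.2⟩

omit P Ψ d n hnd p c in
/-- Auxiliary step (elementary consequence of the standing hypotheses). [folklore] -/
theorem tupSum_powv_comp_perm (σ : Equiv.Perm (Fin s)) (x : Fin s → ℤ) :
    tupSum (powv k q) (x ∘ σ) = tupSum (powv k q) x := by
  simp only [tupSum]
  exact Equiv.sum_comp σ (fun i => powv k q (x i))

/-- Auxiliary step (elementary consequence of the standing hypotheses). [folklore] -/
theorem card_Sol4X_eq (i i₀ : Fin s) : (Sol4X s P Q Ψ q d n hnd p c i).card = (Sol4X s P Q Ψ q d n hnd p c i₀).card := by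
  classical
  set σ : Equiv.Perm (Fin s) := Equiv.swap i₀ i with hσ
  have hσi : σ i₀ = i := by rw [hσ, Equiv.swap_apply_left]
  have hmemt : ∀ {x : Fin s → ℤ} (τ : Equiv.Perm (Fin s)), x ∈ tuples s (Xc Q p c) → x ∘ τ ∈ tuples s (Xc Q p c) :=
    fun τ hx => by rw [mem_tuples] at hx ⊢; exact fun j => hx _
  refine card_bij' (fun a _ => ((a.1.1, a.1.2 ∘ σ), (a.2.1, a.2.2 ∘ σ)))
    (fun a _ => ((a.1.1, a.1.2 ∘ σ.symm), (a.2.1, a.2.2 ∘ σ.symm))) ?_ ?_ ?_ ?_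
  · intro a ha
    rw [Sol4X, mem_filter, mem_Sol4] at ha ⊢
    refine ⟨⟨⟨⟨ha.1.1.1.1, hmemt σ ha.1.1.1.2⟩, ha.1.1.2.1, hmemt σ ha.1.1.2.2⟩, ?_⟩, ?_⟩
    · simp only [Kfreq, tupSum_powv_comp_perm]; exact ha.1.2
    · simp only [Function.comp_apply, hσi]; exact ha.2
  · intro a ha
    rw [Sol4X, mem_filter, mem_Sol4] at ha ⊢
    refine ⟨⟨⟨⟨ha.1.1.1.1, hmemt σ.symm ha.1.1.1.2⟩, ha.1.1.2.1, hmemt σ.symm ha.1.1.2.2⟩, ?_⟩, ?_⟩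
    · simp only [Kfreq, tupSum_powv_comp_perm]; exact ha.1.2
    · simp only [Function.comp_apply]
      rw [show σ.symm i = i₀ by rw [← hσi]; simp]; exact ha.2
  · intro a _; ext <;> simp
  · intro a _; ext <;> simp

/-- `S₅ ≤ 2s · N₀` with `N₀ = #Sol4X i₀`. [cite: Ford2002, proof of Lemma 3.2 ("S₄ ≤ 2S₅ ≤ 4s ∫ …")] -/
theorem card_S5_le (i₀ : Fin s) :
    ((Sol4 s P Q Ψ q d n hnd p c).filter fun a => ¬ ((∀ i, ¬ Top Q p c (a.1.2 i)) ∧ ∀ i, ¬ Top Q p c (a.2.2 i))).card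
      ≤ 2 * s * (Sol4X s P Q Ψ q d n hnd p c i₀).card := by
  classical
  have hcover : ((Sol4 s P Q Ψ q d n hnd p c).filter fun a => ¬ ((∀ i, ¬ Top Q p c (a.1.2 i)) ∧ ∀ i, ¬ Top Q p c (a.2.2 i)))
      ⊆ (univ : Finset (Fin s)).biUnion fun i => Sol4X s P Q Ψ q d n hnd p c i ∪ Sol4Y s P Q Ψ q d n hnd p c i := by
    intro a ha
    rw [mem_filter] at ha
    rw [mem_biUnion]
    rcases not_and_or.1 ha.2 with h1 | h1 <;> push Not at h1 <;> obtain ⟨i, hi⟩ := h1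
    · exact ⟨i, mem_univ _, mem_union_left _ (by rw [Sol4X, mem_filter]; exact ⟨ha.1, hi⟩)⟩
    · exact ⟨i, mem_univ _, mem_union_right _ (by rw [Sol4Y, mem_filter]; exact ⟨ha.1, hi⟩)⟩
  refine (card_le_card hcover).trans (card_biUnion_le.trans ?_)
  have hterm : ∀ i ∈ (univ : Finset (Fin s)), (Sol4X s P Q Ψ q d n hnd p c i ∪ Sol4Y s P Q Ψ q d n hnd p c i).card
      ≤ 2 * (Sol4X s P Q Ψ q d n hnd p c i₀).card := by
    intro i _
    refine (card_union_le _ _).trans ?_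
    rw [card_Sol4Y_eq, card_Sol4X_eq s P Q Ψ q d n hnd p c i i₀]; omega
  refine (sum_le_sum hterm).trans ?_
  rw [sum_const, card_univ, Fintype.card_fin, smul_eq_mul]; ring_nf; exact le_rfl

/-! #### The fixed-variable count and Hölder -/

/-- **`N₀ ≤ ∫ |F̃|² |g|^{2s−1}`** (`s = s' + 1`): a solution with `x_0` in the top cell has `x_0 = t₀`
determined. [cite: Ford2002, proof of Lemma 3.2 ("2S₅ ≤ 4s ∫ |F̃(α)² g(α;c)^{2s−1}| dα")] -/
theorem card_Sol4X0_le_integral {s' : ℕ} (hp : 0 < p) :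
    ((Sol4X (s' + 1) P Q Ψ q d n hnd p c 0).card : ℝ)
      ≤ ∫ α in box k, absFt P Ψ d n hnd p α ^ 2 * absg Q q p c α ^ (2 * (s' + 1) - 1) := by
  classical
  by_cases htop : ∃ t₀ ∈ Xc Q p c, Top Q p c t₀
  swap
  · -- empty top cell: `N₀ = 0`
    have h0 : (Sol4X (s' + 1) P Q Ψ q d n hnd p c 0).card = 0 := by
      rw [card_eq_zero, eq_empty_iff_forall_notMem]
      intro a ha
      rw [Sol4X, mem_filter, mem_Sol4] at ha
      exact htop ⟨a.1.2 0, mem_tuples.1 ha.1.1.1.2 0, ha.2⟩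
    rw [h0]; push_cast
    exact setIntegral_nonneg (measurableSet_box k) fun α _ => by simp only [absFt, absg]; positivity
  obtain ⟨t₀, ht₀, htop₀⟩ := htop
  set Z := Zt P Ψ d n hnd p with hZ
  set Xt := tuples s' (Xc Q p c) with hXt
  set A'' := Z ×ˢ Xt with hA''
  set w₂ : (Fin s' → ℤ) → Fin k → ℤ := fun y => powv k q t₀ + tupSum (powv k q) y with hw₂
  set v'' : (Fin k → ℤ) × (Fin s' → ℤ) → Fin k → ℤ := fun a => tupSum (sysv Ψ) a.1 + w₂ a.2 with hv''
  set B := Z ×ˢ tuples (s' + 1) (Xc Q p c) with hB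
  -- injection
  have hinj : (Sol4X (s' + 1) P Q Ψ q d n hnd p c 0).card
      ≤ ((A'' ×ˢ B).filter fun ba => v'' ba.1 = Kfreq Ψ q ba.2).card := by
    refine card_le_card_of_injOn (fun a => ((a.1.1, fun i => a.1.2 i.succ), a.2)) ?_ ?_
    · intro a ha
      rw [mem_coe, Sol4X, mem_filter, mem_Sol4] at ha
      obtain ⟨⟨⟨⟨hz, hx⟩, hw, hy⟩, heq⟩, ht⟩ := ha
      have hx0 : a.1.2 0 = t₀ := top_unique Q p c hp (mem_tuples.1 hx 0) ht₀ ht htop₀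
      rw [mem_coe, mem_filter, mem_product, hA'', mem_product, hB, mem_product]
      refine ⟨⟨⟨hz, mem_tuples.2 fun i => mem_tuples.1 hx _⟩, hw, hy⟩, ?_⟩
      rw [← heq]
      simp only [hv'', hw₂, Kfreq]
      congr 1
      simp only [tupSum]
      rw [Fin.sum_univ_succ, hx0]
    · intro a ha b hb hab
      rw [mem_coe, Sol4X, mem_filter, mem_Sol4] at ha hb
      simp only [Prod.mk.injEq] at hab
      have ha0 : a.1.2 0 = t₀ := top_unique Q p c hp (mem_tuples.1 ha.1.1.1.2 0) ht₀ ha.2 htop₀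
      have hb0 : b.1.2 0 = t₀ := top_unique Q p c hp (mem_tuples.1 hb.1.1.1.2 0) ht₀ hb.2 htop₀
      refine Prod.ext (Prod.ext hab.1.1 ?_) hab.2
      funext i
      refine Fin.cases ?_ (fun i => ?_) i
      · rw [ha0, hb0]
      · exact congrFun hab.1.2 i
  -- the pair count as an integral
  have hcount := integral_tp_mul_conj_tp (n := k) A'' B v'' (Kfreq Ψ q)
  have htpA : ∀ α, tp A'' v'' α = tp Z (tupSum (sysv Ψ)) α * (E (powv k q t₀) α * tp (Xc Q p c) (powv k q) α ^ s') := by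
    intro α
    rw [hA'', hv'', ← tp_mul]
    congr 1
    rw [hXt, ← tp_tuples_tupSum, hw₂]
    unfold tp
    rw [Finset.mul_sum]
    refine sum_congr rfl fun x _ => ?_
    rw [E_add]
  have htpB : ∀ α, tp B (Kfreq Ψ q) α = tp Z (tupSum (sysv Ψ)) α * tp (Xc Q p c) (powv k q) α ^ (s' + 1) := by
    intro α
    have e : tp B (Kfreq Ψ q) α = tp Z (tupSum (sysv Ψ)) α * tp (tuples (s' + 1) (Xc Q p c)) (tupSum (powv k q)) α := by
      rw [hB, tp_mul]; rfl
    rw [e, tp_tuples_tupSum]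
  have hnorm : ∀ α, ‖tp A'' v'' α * conj (tp B (Kfreq Ψ q) α)‖
      = absFt P Ψ d n hnd p α ^ 2 * absg Q q p c α ^ (2 * (s' + 1) - 1) := by
    intro α
    rw [norm_mul, Complex.norm_conj, htpA, htpB]
    simp only [norm_mul, norm_pow, norm_E, one_mul, absFt, absg, hZ]
    rw [show 2 * (s' + 1) - 1 = s' + (s' + 1) by omega]; ring
  have step2 : ((((A'' ×ˢ B).filter fun ba => v'' ba.1 = Kfreq Ψ q ba.2).card : ℕ) : ℝ)
      ≤ ∫ α in box k, absFt P Ψ d n hnd p α ^ 2 * absg Q q p c α ^ (2 * (s' + 1) - 1) := by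
    have h1 : ((((A'' ×ˢ B).filter fun ba => v'' ba.1 = Kfreq Ψ q ba.2).card : ℕ) : ℝ)
        = ‖∫ α in box k, tp A'' v'' α * conj (tp B (Kfreq Ψ q) α)‖ := by rw [hcount]; simp
    rw [h1]
    refine (norm_integral_le_integral_norm _).trans (le_of_eq ?_)
    exact setIntegral_congr_fun (measurableSet_box _) fun α _ => hnorm α
  calc ((Sol4X (s' + 1) P Q Ψ q d n hnd p c 0).card : ℝ) ≤ _ := by exact_mod_cast hinj
    _ ≤ _ := step2

/-- **Hölder**: `∫ |F̃|²|g|^{2s−1} ≤ (∫|F̃|²|g|^{2s})^{1−1/(2s)} (∫|F̃|²)^{1/(2s)}` (`s ≥ 1`).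
[cite: Ford2002, proof of Lemma 3.2 (the display after "By (2.?)," in the case `S₅ ≥ S₆`)] -/
theorem holder_boundary {s : ℕ} (hs : 1 ≤ s) :
    ∫ α in box k, absFt P Ψ d n hnd p α ^ 2 * absg Q q p c α ^ (2 * s - 1)
      ≤ (∫ α in box k, absFt P Ψ d n hnd p α ^ 2 * absg Q q p c α ^ (2 * s)) ^ (1 - 1 / (2 * (s : ℝ)))
        * (∫ α in box k, absFt P Ψ d n hnd p α ^ 2) ^ (1 / (2 * (s : ℝ))) := by
  set Φ := absFt P Ψ d n hnd p with hΦ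
  set φ := absg Q q p c with hφ
  have hΦ0 : ∀ α, 0 ≤ Φ α := fun α => norm_nonneg _
  have hφ0 : ∀ α, 0 ≤ φ α := fun α => norm_nonneg _
  have hΦc : Continuous Φ := (continuous_tp _ _).norm
  have hφc : Continuous φ := (continuous_tp _ _).norm
  have hsR : (1 : ℝ) ≤ s := by exact_mod_cast hs
  have hs0 : (0 : ℝ) < s := by linarith
  have hsne : (s : ℝ) ≠ 0 := hs0.ne'
  have h2s1 : 2 * (s : ℝ) - 1 ≠ 0 := ne_of_gt (by linarith)
  set G₁ : (Fin k → ℝ) → ℝ := fun α => Φ α ^ ((2 * (s : ℝ) - 1) / s) * φ α ^ (2 * s - 1) with hG₁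
  set G₂ : (Fin k → ℝ) → ℝ := fun α => Φ α ^ (1 / (s : ℝ)) with hG₂
  have hG₁0 : ∀ α, 0 ≤ G₁ α := fun α => mul_nonneg (Real.rpow_nonneg (hΦ0 α) _) (pow_nonneg (hφ0 α) _)
  have hG₂0 : ∀ α, 0 ≤ G₂ α := fun α => Real.rpow_nonneg (hΦ0 α) _
  have hexp0 : 0 ≤ (2 * (s : ℝ) - 1) / s := by apply div_nonneg <;> linarith
  have hG₁c : Continuous G₁ := (hΦc.rpow_const fun _ => Or.inr hexp0).mul (hφc.pow _)
  have hG₂c : Continuous G₂ := hΦc.rpow_const fun _ => Or.inr (by positivity)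
  have hpq : (2 * (s : ℝ) / (2 * s - 1)).HolderConjugate (2 * (s : ℝ)) := by
    rw [Real.holderConjugate_iff]
    refine ⟨by rw [lt_div_iff₀ (by linarith)]; linarith, ?_⟩
    field_simp; ring
  have hprod : ∀ α, Φ α ^ 2 * φ α ^ (2 * s - 1) = G₁ α * G₂ α := by
    intro α
    simp only [hG₁, hG₂]
    have e : Φ α ^ 2 = Φ α ^ ((2 * (s : ℝ) - 1) / s) * Φ α ^ (1 / (s : ℝ)) := by
      rw [← Real.rpow_add_of_nonneg (hΦ0 α) hexp0 (by positivity),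
        show ((2 * (s : ℝ) - 1) / s + 1 / (s : ℝ)) = ((2 : ℕ) : ℝ) by field_simp; ring, Real.rpow_natCast]
    rw [e]; ring
  have step := holder_box hG₁c hG₂c hG₁0 hG₂0 hpq
  simp_rw [← hprod] at step
  have hG₁pow : ∀ α, G₁ α ^ (2 * (s : ℝ) / (2 * s - 1)) = Φ α ^ 2 * φ α ^ (2 * s) := by
    intro α
    simp only [hG₁]
    rw [Real.mul_rpow (Real.rpow_nonneg (hΦ0 α) _) (pow_nonneg (hφ0 α) _), ← Real.rpow_mul (hΦ0 α),
      ← Real.rpow_natCast (φ α), ← Real.rpow_mul (hφ0 α)]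
    have e1 : (2 * (s : ℝ) - 1) / s * (2 * (s : ℝ) / (2 * s - 1)) = ((2 : ℕ) : ℝ) := by
      field_simp; push_cast; ring
    have e2 : ((2 * s - 1 : ℕ) : ℝ) * (2 * (s : ℝ) / (2 * s - 1)) = ((2 * s : ℕ) : ℝ) := by
      rw [Nat.cast_sub (by omega)]; push_cast; field_simp
    rw [e1, e2, Real.rpow_natCast, Real.rpow_natCast]
  have hG₂pow : ∀ α, G₂ α ^ (2 * (s : ℝ)) = Φ α ^ 2 := by
    intro α
    simp only [hG₂]
    rw [← Real.rpow_mul (hΦ0 α), show (1 / (s : ℝ)) * (2 * s) = ((2 : ℕ) : ℝ) by field_simp; push_cast; ring,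
      Real.rpow_natCast]
  simp_rw [hG₁pow, hG₂pow] at step
  have e3 : 1 / (2 * (s : ℝ) / (2 * s - 1)) = 1 - 1 / (2 * (s : ℝ)) := by field_simp
  rw [e3] at step
  exact step

/-- The diagonal `S₄ ≥ |Xc|^s Z`. [cite: Ford2002, proof of Lemma 3.2 ("counting only the solutions of (3.5)
with u_i = v_i gives S₄(c,p) ≥ (Q/p)^s ∫ |F̃|²")] -/
theorem card_Xc_pow_mul_Z_le : (Xc Q p c).card ^ s * Zcount P Ψ d n hnd p ≤ S4 s P Q Ψ q d n hnd p c := by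
  classical
  rw [Zcount, ← card_Sol4, ← card_tuples, ← card_product]
  refine card_le_card_of_injOn (fun w => ((w.2.1, w.1), (w.2.2, w.1))) ?_ ?_
  · intro w hw
    rw [mem_coe, mem_product, mem_filter, mem_product] at hw
    rw [mem_coe, mem_Sol4]
    refine ⟨⟨⟨hw.2.1.1, hw.1⟩, hw.2.1.2, hw.1⟩, ?_⟩
    simp only [Kfreq]; rw [hw.2.2]
  · intro w _ w' _ h
    simp only [Prod.mk.injEq] at h
    exact Prod.ext h.1.2 (Prod.ext h.1.1 h.2.1)

/-! #### `S₄ ≤ 2 S₆` -/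

set_option maxHeartbeats 800000 in
/-- **`S₄(c,p) ≤ 2 S₆(c,p)`** when `Q ≥ 16 s² p`. [cite: Ford2002, proof of Lemma 3.2 ("By our assumed lower
bound on Q, this is impossible. Therefore, S₄(c,p) ≤ 2S₆(c,p)")] -/
theorem S4_le_two_S6 {s' : ℕ} (hp : 0 < p) (hQ : 16 * (s' + 1) ^ 2 * p ≤ Q) :
    S4 (s' + 1) P Q Ψ q d n hnd p c ≤ 2 * (Sol6 (s' + 1) P Q Ψ q d n hnd p c).card := by
  classical
  -- combinatorial facts
  have hsplit : S4 (s' + 1) P Q Ψ q d n hnd p c = (Sol6 (s' + 1) P Q Ψ q d n hnd p c).card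
      + ((Sol4 (s' + 1) P Q Ψ q d n hnd p c).filter fun a =>
          ¬ ((∀ i, ¬ Top Q p c (a.1.2 i)) ∧ ∀ i, ¬ Top Q p c (a.2.2 i))).card := by
    rw [← card_Sol4, Sol6]
    exact (Finset.card_filter_add_card_filter_not (s := Sol4 (s' + 1) P Q Ψ q d n hnd p c)
      (fun a => (∀ i, ¬ Top Q p c (a.1.2 i)) ∧ ∀ i, ¬ Top Q p c (a.2.2 i))).symm
  have hS5 := card_S5_le (s' + 1) P Q Ψ q d n hnd p c 0
  have hN0 := card_Sol4X0_le_integral P Q Ψ q d n hnd p c (s' := s') hp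
  have hH := holder_boundary P Q Ψ q d n hnd p c (s := s' + 1) (by omega)
  rw [show 2 * (s' + 1) - 1 = 2 * (s' + 1) - 1 from rfl] at hN0
  rw [← S4_eq_integral, ← Zcount_eq_integral] at hH
  have hdiag := card_Xc_pow_mul_Z_le (s' + 1) P Q Ψ q d n hnd p c
  -- abbreviations
  set S₄ := S4 (s' + 1) P Q Ψ q d n hnd p c with hS₄
  set S₆ := (Sol6 (s' + 1) P Q Ψ q d n hnd p c).card with hS₆
  set N₀ := (Sol4X (s' + 1) P Q Ψ q d n hnd p c 0).card with hN₀
  set Z := Zcount P Ψ d n hnd p with hZdef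
  by_contra hcon
  push Not at hcon
  have hS4lt : S₄ < 2 * (2 * (s' + 1) * N₀) := by omega
  -- `N₀ > 0`, so the top cell is occupied and `|Xc| ≥ Q/p ≥ 16 s²`
  have hN₀pos : 0 < N₀ := by
    by_contra h0; push Not at h0
    have : N₀ = 0 := by omega
    rw [this] at hS4lt; simp at hS4lt
  obtain ⟨a, ha⟩ := Finset.card_pos.1 hN₀pos
  rw [Sol4X, mem_filter, mem_Sol4] at ha
  have hXc := card_Xc_ge Q p c hp (mem_tuples.1 ha.1.1.1.2 0) ha.2
  have hsR : (1 : ℝ) ≤ ((s' + 1 : ℕ) : ℝ) := by exact_mod_cast (by omega : 1 ≤ s' + 1)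
  set sR : ℝ := ((s' + 1 : ℕ) : ℝ) with hsRdef
  have hs0 : 0 < sR := by linarith
  have hXc16 : 16 * sR ^ 2 ≤ (Xc Q p c).card := by
    refine le_trans ?_ hXc
    rw [le_div_iff₀ (by exact_mod_cast hp), hsRdef]
    exact_mod_cast hQ
  -- reals
  have hS4R : (S₄ : ℝ) < 4 * sR * N₀ := by
    have : (S₄ : ℝ) < ((2 * (2 * (s' + 1) * N₀) : ℕ) : ℝ) := by exact_mod_cast hS4lt
    push_cast at this; rw [hsRdef]; push_cast; linarith
  have hS4pos : (0 : ℝ) < S₄ := by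
    have : (0 : ℝ) ≤ S₆ := by positivity
    have : ((2 * S₆ : ℕ) : ℝ) < S₄ := by exact_mod_cast hcon
    push_cast at this; linarith
  have hZ0 : (0 : ℝ) ≤ Z := by positivity
  -- `N₀ ≤ S₄^{1−1/2s} Z^{1/2s}`
  have hN0' : (N₀ : ℝ) ≤ (S₄ : ℝ) ^ (1 - 1 / (2 * sR)) * (Z : ℝ) ^ (1 / (2 * sR)) := hN0.trans hH
  -- hence `S₄^{1/2s} < 4s Z^{1/2s}` and `S₄ < (4s)^{2s} Z`
  have hroot : (S₄ : ℝ) ^ (1 / (2 * sR)) < 4 * sR * (Z : ℝ) ^ (1 / (2 * sR)) := by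
    have e : (S₄ : ℝ) = (S₄ : ℝ) ^ (1 - 1 / (2 * sR)) * (S₄ : ℝ) ^ (1 / (2 * sR)) := by
      rw [← Real.rpow_add hS4pos]; simp
    have hpos : 0 < (S₄ : ℝ) ^ (1 - 1 / (2 * sR)) := Real.rpow_pos_of_pos hS4pos _
    have h2 : (S₄ : ℝ) ^ (1 - 1 / (2 * sR)) * (S₄ : ℝ) ^ (1 / (2 * sR))
        < (S₄ : ℝ) ^ (1 - 1 / (2 * sR)) * (4 * sR * (Z : ℝ) ^ (1 / (2 * sR))) := by
      calc (S₄ : ℝ) ^ (1 - 1 / (2 * sR)) * (S₄ : ℝ) ^ (1 / (2 * sR)) = S₄ := e.symm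
        _ < 4 * sR * N₀ := hS4R
        _ ≤ 4 * sR * ((S₄ : ℝ) ^ (1 - 1 / (2 * sR)) * (Z : ℝ) ^ (1 / (2 * sR))) :=
            mul_le_mul_of_nonneg_left hN0' (by positivity)
        _ = _ := by ring
    exact lt_of_mul_lt_mul_left h2 hpos.le
  have hS4bound : (S₄ : ℝ) < (4 * sR) ^ (2 * (s' + 1)) * Z := by
    have h1 := pow_lt_pow_left₀ hroot (Real.rpow_nonneg hS4pos.le _) (show 2 * (s' + 1) ≠ 0 by omega)
    rw [← Real.rpow_natCast ((S₄ : ℝ) ^ _), ← Real.rpow_mul hS4pos.le, mul_pow,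
      ← Real.rpow_natCast ((Z : ℝ) ^ _), ← Real.rpow_mul hZ0] at h1
    have e : 1 / (2 * sR) * ((2 * (s' + 1) : ℕ) : ℝ) = 1 := by rw [hsRdef]; push_cast; field_simp
    rw [e, Real.rpow_one, Real.rpow_one] at h1
    exact h1
  -- diagonal: `S₄ ≥ |Xc|^s Z ≥ (16 s²)^s Z = (4s)^{2s} Z`
  have hdiagR : ((Xc Q p c).card : ℝ) ^ (s' + 1) * Z ≤ S₄ := by exact_mod_cast hdiag
  have hpowle : (4 * sR) ^ (2 * (s' + 1)) ≤ ((Xc Q p c).card : ℝ) ^ (s' + 1) := by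
    rw [pow_mul, show (4 * sR) ^ 2 = 16 * sR ^ 2 by ring]
    exact pow_le_pow_left₀ (by positivity) hXc16 _
  have := mul_le_mul_of_nonneg_right hpowle hZ0
  linarith

/-! ### Step F: re-expansion `x = pu − c̃` -/

omit s P Ψ q d n hnd p c in
/-- A `Fin k`-indexed sum over `ℓ ≤ j` as a sum over `range (j+1)`. [folklore] -/
theorem sum_filter_le_eq_sum_range (j : Fin k) (F : ℕ → ℤ) :
    ∑ ℓ ∈ univ.filter (fun ℓ : Fin k => ℓ ≤ j), F ℓ.val = ∑ m ∈ range (j.val + 1), F m := by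
  classical
  rw [sum_filter]
  have h1 := Fin.sum_univ_eq_sum_range (fun m => if m ≤ j.val then F m else 0) k
  have h2 : ∀ ℓ : Fin k, (if ℓ ≤ j then F ℓ.val else 0) = (if ℓ.val ≤ j.val then F ℓ.val else 0) := fun ℓ => rfl
  simp_rw [h2]
  rw [h1, ← sum_filter]
  congr 1
  ext m; simp [Finset.mem_filter, Finset.mem_range]; omega

omit s P Ψ d n hnd in
/-- **The binomial re-expansion of one variable**: if `p u = x + c̃` then
`(pq)^{j} u^{j} = ∑_{ℓ ≤ j} C(j,ℓ) (c̃q)^{j−ℓ} q^{ℓ} x^{ℓ} + (c̃q)^j` (degrees shifted by one in the `Fin k`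
indexing). [cite: Ford2002, proof of Lemma 3.2 ("By the binomial theorem, (py)^j = ∑ C(j,ℓ)(py−c)^ℓ c^{j−ℓ}")] -/
theorem powv_reexpand {u x : ℤ} (hux : (p : ℤ) * u = x + ctil p c) (j : Fin k) :
    powv k ((p : ℤ) * q) u j
      = ∑ ℓ ∈ univ.filter (fun ℓ : Fin k => ℓ ≤ j),
          ((j.val + 1).choose (ℓ.val + 1) : ℤ) * (ctil p c * q) ^ (j.val - ℓ.val) * powv k q x ℓ
        + (ctil p c * q) ^ (j.val + 1) := by
  simp only [powv]
  rw [mul_pow, show ((p : ℤ) ^ (j.val + 1) * q ^ (j.val + 1) * u ^ (j.val + 1))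
      = q ^ (j.val + 1) * ((p : ℤ) * u) ^ (j.val + 1) by ring, hux, add_pow]
  -- convert the `Fin`-sum to a `range`-sum
  have hconv := sum_filter_le_eq_sum_range j
    (fun m => ((j.val + 1).choose (m + 1) : ℤ) * (ctil p c * q) ^ (j.val - m) * (q ^ (m + 1) * x ^ (m + 1)))
  rw [hconv, Finset.mul_sum, Finset.sum_range_succ']
  simp only [pow_zero, Nat.sub_zero, Nat.choose_zero_right, Nat.cast_one, mul_one, one_mul]
  congr 1
  · refine sum_congr rfl fun m hm => ?_
    rw [mem_range] at hm
    have e : q ^ (j.val + 1) = q ^ (m + 1) * q ^ (j.val - m) := by rw [← pow_add]; congr 1; omega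
    rw [show j.val + 1 - (m + 1) = j.val - m by omega, e]
    ring
  · rw [mul_pow]; ring

/-- The translated count `S₆'`: `z, w ∈ Z̃`, `1 ≤ u_i, v_i ≤ Q/p`, system `Φ = transl (c̃q) Ψ` with moduli
`pq`. [cite: Ford2002, (3.6)] -/
def Sol6' : Finset (((Fin k → ℤ) × (Fin s → ℤ)) × ((Fin k → ℤ) × (Fin s → ℤ))) :=
  ((Zt P Ψ d n hnd p ×ˢ tuples s (Finset.Icc 1 ((Q / p : ℕ) : ℤ)))
      ×ˢ (Zt P Ψ d n hnd p ×ˢ tuples s (Finset.Icc 1 ((Q / p : ℕ) : ℤ)))).filter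
    fun a => Kfreq (transl (ctil p c * q) Ψ) ((p : ℤ) * q) a.1 = Kfreq (transl (ctil p c * q) Ψ) ((p : ℤ) * q) a.2

/-- **The translated frequency is an affine image of the original one**:
`Kfreq Φ (pq) (z,u)_j = ∑_{ℓ ≤ j} C(j+1,ℓ+1)(c̃q)^{j−ℓ} Kfreq Ψ q (z,x)_ℓ + s (c̃q)^{j+1}` when `p u_i = x_i + c̃`.
[cite: Ford2002, proof of Lemma 3.2 ("Thus, S₆(c,p) is the number of solutions of (3.6)")] -/
theorem Kfreq_transl {z : Fin k → ℤ} {u x : Fin s → ℤ} (hux : ∀ i, (p : ℤ) * u i = x i + ctil p c) (j : Fin k) :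
    Kfreq (transl (ctil p c * q) Ψ) ((p : ℤ) * q) (z, u) j
      = ∑ ℓ ∈ univ.filter (fun ℓ : Fin k => ℓ ≤ j),
          ((j.val + 1).choose (ℓ.val + 1) : ℤ) * (ctil p c * q) ^ (j.val - ℓ.val) * Kfreq Ψ q (z, x) ℓ
        + s * (ctil p c * q) ^ (j.val + 1) := by
  simp only [Kfreq, Pi.add_apply, tupSum, Finset.sum_apply, sysv]
  simp_rw [transl_eval, powv_reexpand q p c (hux _) j]
  rw [Finset.sum_add_distrib, Finset.sum_const, card_univ, Fintype.card_fin, nsmul_eq_mul]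
  simp_rw [mul_add, Finset.sum_add_distrib, Finset.mul_sum]
  rw [Finset.sum_comm (s := univ) (t := univ.filter fun ℓ : Fin k => ℓ ≤ j),
    Finset.sum_comm (s := (univ : Finset (Fin s))) (t := univ.filter fun ℓ : Fin k => ℓ ≤ j)]
  ring

/-- **`S₆ ≤ S₆'`** by `x_i = pu_i − c̃`. [cite: Ford2002, proof of Lemma 3.2 ((3.5) → (3.6))] -/
theorem card_Sol6_le (hp : 0 < p) : (Sol6 s P Q Ψ q d n hnd p c).card ≤ (Sol6' s P Q Ψ q d n hnd p c).card := by
  classical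
  set udiv : ℤ → ℤ := fun x => (x + ctil p c) / p with hudiv
  have hp' : (0 : ℤ) < p := by exact_mod_cast hp
  refine card_le_card_of_injOn (fun a => ((a.1.1, fun i => udiv (a.1.2 i)), (a.2.1, fun i => udiv (a.2.2 i)))) ?_ ?_
  · intro a ha
    rw [mem_coe, Sol6, mem_filter, mem_Sol4] at ha
    obtain ⟨⟨⟨⟨hz, hx⟩, hw, hy⟩, heq⟩, hnx, hny⟩ := ha
    rw [mem_tuples] at hx hy
    rw [mem_coe, Sol6', mem_filter, mem_product, mem_product, mem_product]
    refine ⟨⟨⟨hz, mem_tuples.2 fun i => udiv_mem Q p c hp (hx i) (hnx i)⟩, hw,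
      mem_tuples.2 fun i => udiv_mem Q p c hp (hy i) (hny i)⟩, ?_⟩
    have hux : ∀ i, (p : ℤ) * udiv (a.1.2 i) = a.1.2 i + ctil p c := fun i =>
      Int.mul_ediv_cancel' (dvd_add_ctil Q p c (hx i))
    have huy : ∀ i, (p : ℤ) * udiv (a.2.2 i) = a.2.2 i + ctil p c := fun i =>
      Int.mul_ediv_cancel' (dvd_add_ctil Q p c (hy i))
    funext j
    rw [Kfreq_transl s Ψ q p c hux j, Kfreq_transl s Ψ q p c huy j, heq]
  · intro a ha b hb hab
    rw [mem_coe, Sol6, mem_filter, mem_Sol4] at ha hb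
    simp only [Prod.mk.injEq] at hab
    have hrec : ∀ {x y : ℤ}, x ∈ Xc Q p c → y ∈ Xc Q p c → udiv x = udiv y → x = y := by
      intro x y hx hy h
      have h1 : (p : ℤ) * udiv x = x + ctil p c := Int.mul_ediv_cancel' (dvd_add_ctil Q p c hx)
      have h2 : (p : ℤ) * udiv y = y + ctil p c := Int.mul_ediv_cancel' (dvd_add_ctil Q p c hy)
      have : x + ctil p c = y + ctil p c := by rw [← h1, ← h2, h]
      linarith
    refine Prod.ext (Prod.ext hab.1.1 ?_) (Prod.ext hab.2.1 ?_)
    · funext i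
      exact hrec (mem_tuples.1 ha.1.1.1.2 i) (mem_tuples.1 hb.1.1.1.2 i) (congrFun hab.1.2 i)
    · funext i
      exact hrec (mem_tuples.1 ha.1.1.2.2 i) (mem_tuples.1 hb.1.1.2.2 i) (congrFun hab.2.2 i)

/-- **Steps E–F combined**: `S₄(c,p) ≤ 2 S₆'(c,p)` for `Q ≥ 16 s² p`, `s ≥ 1`. [cite: Ford2002, proof of
Lemma 3.2, (3.5)–(3.6)] -/
theorem S4_le_two_S6' {s' : ℕ} (hp : 0 < p) (hQ : 16 * (s' + 1) ^ 2 * p ≤ Q) :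
    S4 (s' + 1) P Q Ψ q d n hnd p c ≤ 2 * (Sol6' (s' + 1) P Q Ψ q d n hnd p c).card :=
  (S4_le_two_S6 P Q Ψ q d n hnd p c hp hQ).trans (Nat.mul_le_mul_left 2 (card_Sol6_le (s' + 1) P Q Ψ q d n hnd p c hp))

end StepE

end FordVK
end Literature.NumberTheory.LFunctions
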